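import Summits.BirchSwinnertonDyer.Rank1Residual.X11b.BDPRouteControlSnake
import HarnessLib

/-!
# Class X11b, route p2: the local kernel `ker r_v` embeds into the coinvariants
# `B_v/(γ_v − 1)B_v`, `B_v = M^{D_v ⊓ Gal(K̄/K_∞)}` (inflation–restriction half of Greenberg's
# Lemma 3.3, on the constructed objects) (cell `b2b-bsdres`, sub-cell `multr1-p2`, gen 13)

HONEST FRAMING (verbatim, cell `b2b-bsdres`): the goal of the cell is to DELETE the
COMBINATION-SHAPED residual classes for ALL analytic-rank `≤ 1` curves over `ℚ` — "full BSD
formula for every rank `≤ 1` curve in class `C`" assembled STRICTLY from published theorems — so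
that the rank-`≤ 1` remainder becomes exactly the CONSTRUCTION-SHAPED classes, which are TYPED
(missing-input Props), NOT attempted; this is not "finishing BSD". Research route `p2` for class
X11b; no claim beyond the stated class; nothing booked; X11b stays CONSTRUCTION-SHAPED. One
definition with a body (`decompSubOne`, the endomorphism `γ_v − 1`) and theorems; no named fact; no
`sorry`. Continues `BDPRouteControlSnake.lean` (the counting snake lemma: route p2's control input
reduced to bounds on `#ker r_v` at the bad places and one bound on `#Sel_𝔭(K, E[p^∞])`) and
`BDPRouteLocalKernelAlgebra.lean` (the algebra `#B/(γ−1)B ≤ c_v^{(p)}`).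

## Content

Greenberg (LNM 1716, §3, proof of Lemma 3.3, p. 87): "`ker(r_v) ≅ H¹(F_{∞,η}/F_v, E(F_{∞,η})[p^∞])`
… `Γ_v = Gal(F_{∞,η}/F_v)` is topologically cyclic … `H¹(Γ_v, B_v) = B_v/(γ_v − 1)B_v`". On the
tree's objects (`GreenbergSelmer.decomp v = D_v ≤ Γ_K`, a `ℤ_p`-extension `κ` with
`Gal(K̄/K_∞) = ker κ`, a discrete `Γ_K`-module `M` with continuous orbit maps):

* `exists_generator_of_continuousMonoidHom_padicInt` — GENERIC: for a compact topological group `G`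
  and a continuous `λ : G →* ℤ_p` there is `g ∈ G` such that every open subgroup containing `ker λ`
  and `g` is all of `G` ("`λ(G) ≤ ℤ_p` is procyclic"; the tree's
  `ZpExtension.exists_mem_localSubgroup_generate` is the case `G = Γ_{K_v}`, `λ = κ ∘ res`; same
  proof: minimal valuation + density of `ℕ` in `ℤ_p`).
* `exists_mem_decomp_generate` — applied to `G = D_v` (compact: closed image of `Γ_{K_v}`) and
  `λ = κ|_{D_v}`: a `γ_v ∈ D_v` generating `D_v` topologically together with `D_v ⊓ ker κ`.
* `decompSubOne κ M v g hg` — the endomorphism `γ_v − 1` of `B_v := M^{ker κ ⊓ D_v}` for `g ∈ D_v`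
  (`g` normalises `ker κ ⊓ D_v`).
* **`finite_localKer_and_natCard_le`** — `localKer (ker κ) M v = ker (H¹(D_v, M) → H¹(D_v ⊓ ker κ, M))`
  (gen 13, `BDPRouteControlSnake`) is finite with `#localKer ≤ #(B_v/(γ_v − 1)B_v)` whenever the
  latter is finite, for any `γ_v` as above — the tree's generic embedding
  `ResKernel.finite_subgroupResKer` (`H¹(G/N, M^N) ↪ M^N/(γ − 1)M^N`) for the topological group
  `D_v`, its normal subgroup `D_v ⊓ ker κ` and `γ_v`, transported exactly as in
  `WeierstrassCurve.finite_ker_layerToInfty_and_card_le` (Lemma 3.1).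

With `BDPRouteLocalKernelAlgebra` this leaves, for the bad-place input (c) of route p2's (CTL≤)ᵗ,
the GEOMETRIC identifications only: `B_v/(γ_v−1)B_v` vs `E(K_{∞,w})`, `E₀`, `[E(K_v):E₀(K_v)] = c_v`
(Kodaira–Néron; divisibility of `E₀(K_{∞,w})[p^∞]`). CONDITIONAL use only; nothing booked.

References: [GreenbergLNM1716] §3 Lemma 3.3 and its proof (p. 87), Lemma 3.1 (p. 86);
[SerreGaloisCohomology1997] I.§2.6 (inflation–restriction), XIII.§1 (procyclic groups).
-/

noncomputable section

open scoped Classical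

open NumberField IsDedekindDomain Field
open Literature.NumberTheory.EllipticCurves Literature.NumberTheory.EllipticCurves.GreenbergSelmer
open Literature.NumberTheory.GaloisRepresentations Literature.NumberTheory.EllipticCurves.ResKernel

universe u

namespace Summit.BirchSwinnertonDyer.Rank1Residual.X11b.AcSelmer

/-! ## A topological generator modulo the kernel of a character to `ℤ_p` -/

section Generator

variable {p : ℕ} [Fact p.Prime]

/-- **Procyclicity of `λ(G) ≤ ℤ_p`.** For a compact topological group `G` and a continuous
homomorphism `λ : G → ℤ_p` there is `g ∈ G` such that every open subgroup `U` of `G` containing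
`ker λ` and `g` is all of `G`. (If `λ = 0` take `g = 1`; otherwise take `g` with `λ(g) = u p^m ≠ 0`
of minimal valuation, so `λ(G) ⊆ p^m ℤ_p`; `λ(U)` is closed and contains `ℕ·λ(g)`, hence
`p^m ℤ_p ∋ λ(x)`; then `x = (x y⁻¹) y` with `λ y = λ x`, `y ∈ U`, `x y⁻¹ ∈ ker λ ⊆ U`.) The tree's
`ZpExtension.exists_mem_localSubgroup_generate` is the case `G = Γ_{K_v}`.
[cite: GreenbergLNM1716, §3 Lemma 3.3 (proof, p. 87: "topologically generated by `γ_{v_n}`")] -/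
theorem exists_generator_of_continuousMonoidHom_padicInt {G : Type*} [Group G]
    [TopologicalSpace G] [IsTopologicalGroup G] [CompactSpace G]
    (lam : G →ₜ* Multiplicative ℤ_[p]) :
    ∃ g : G, ∀ U : Subgroup G, IsOpen (U : Set G) → lam.toMonoidHom.ker ≤ U → g ∈ U → U = ⊤ := by
  let la : G → ℤ_[p] := fun x ↦ (lam x).toAdd
  have hla_cont : Continuous la := continuous_toAdd.comp lam.continuous
  have hla_pow : ∀ (x : G) (k : ℕ), la (x ^ k) = k • la x := fun x k ↦ by
    show (lam (x ^ k)).toAdd = k • (lam x).toAdd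
    rw [map_pow, toAdd_pow]
  have hmemker : ∀ x : G, x ∈ lam.toMonoidHom.ker ↔ la x = 0 := fun x ↦ by
    rw [MonoidHom.mem_ker]
    constructor
    · intro h
      show (lam x).toAdd = 0
      rw [show lam x = 1 from h, toAdd_one]
    · intro h
      exact Multiplicative.toAdd.injective (by rw [toAdd_one]; exact h)
  by_cases htriv : ∀ x : G, la x = 0
  · exact ⟨1, fun U _ hU _ ↦ by
      rw [eq_top_iff]
      exact fun x _ ↦ hU ((hmemker x).mpr (htriv x))⟩
  · simp only [not_forall] at htriv
    obtain ⟨x₀, hne⟩ := htriv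
    have hS : ∃ m : ℕ, ∃ x : G, la x ≠ 0 ∧ (la x).valuation = m := ⟨_, x₀, hne, rfl⟩
    obtain ⟨g, hg0, hgv⟩ := Nat.find_spec hS
    have hmin : ∀ x : G, la x ≠ 0 → Nat.find hS ≤ (la x).valuation :=
      fun x h ↦ Nat.find_min' hS ⟨x, h, rfl⟩
    set m₀ := Nat.find hS with hm₀
    set ug : ℤ_[p]ˣ := PadicInt.unitCoeff hg0 with hug
    have hgeq : la g = (ug : ℤ_[p]) * (p : ℤ_[p]) ^ m₀ := by
      rw [← hgv]; exact PadicInt.unitCoeff_spec hg0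
    have hdiv : ∀ x : G, ∃ z : ℤ_[p], la x = (p : ℤ_[p]) ^ m₀ * z := by
      intro x
      by_cases h : la x = 0
      · exact ⟨0, by rw [h, mul_zero]⟩
      · refine ⟨(PadicInt.unitCoeff h : ℤ_[p]) * (p : ℤ_[p]) ^ ((la x).valuation - m₀), ?_⟩
        calc la x = (PadicInt.unitCoeff h : ℤ_[p]) * (p : ℤ_[p]) ^ (la x).valuation :=
              PadicInt.unitCoeff_spec h
          _ = (PadicInt.unitCoeff h : ℤ_[p]) *
                ((p : ℤ_[p]) ^ m₀ * (p : ℤ_[p]) ^ ((la x).valuation - m₀)) := by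
              rw [← pow_add, Nat.add_sub_cancel' (hmin x h)]
          _ = (p : ℤ_[p]) ^ m₀ *
                ((PadicInt.unitCoeff h : ℤ_[p]) * (p : ℤ_[p]) ^ ((la x).valuation - m₀)) := by
              ring
    refine ⟨g, fun U hUopen hkerU hgU ↦ ?_⟩
    rw [eq_top_iff]
    intro x _
    have hUclosed : IsClosed (U : Set G) := Subgroup.isClosed_of_isOpen U hUopen
    have himg : IsClosed (la '' (U : Set G)) := (hUclosed.isCompact.image hla_cont).isClosed
    have hpow_mem : ∀ k : ℕ, (k : ℤ_[p]) * ((ug : ℤ_[p]) * (p : ℤ_[p]) ^ m₀) ∈ la '' (U : Set G) :=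
      fun k ↦ ⟨g ^ k, U.pow_mem hgU k, by rw [hla_pow, hgeq, nsmul_eq_mul]⟩
    obtain ⟨z, hz⟩ := hdiv x
    have hxmem : la x ∈ la '' (U : Set G) := by
      let F : ℤ_[p] → ℤ_[p] := fun t ↦ t * ((ug : ℤ_[p]) * (p : ℤ_[p]) ^ m₀)
      have hF : Continuous F := continuous_id.mul continuous_const
      have hw : z * ((ug⁻¹ : ℤ_[p]ˣ) : ℤ_[p]) ∈ closure (Set.range (Nat.cast : ℕ → ℤ_[p])) := by
        rw [PadicInt.denseRange_natCast.closure_range]; exact Set.mem_univ _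
      have hcl : F (z * ((ug⁻¹ : ℤ_[p]ˣ) : ℤ_[p])) ∈ closure (la '' (U : Set G)) :=
        map_mem_closure hF hw (by rintro _ ⟨k, rfl⟩; exact hpow_mem k)
      rw [himg.closure_eq] at hcl
      have hFx : F (z * ((ug⁻¹ : ℤ_[p]ˣ) : ℤ_[p])) = la x := by
        show z * ((ug⁻¹ : ℤ_[p]ˣ) : ℤ_[p]) * ((ug : ℤ_[p]) * (p : ℤ_[p]) ^ m₀) = la x
        rw [hz, mul_assoc, ← mul_assoc ((ug⁻¹ : ℤ_[p]ˣ) : ℤ_[p]), Units.inv_mul, one_mul, mul_comm]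
      rwa [hFx] at hcl
    obtain ⟨y, hyU, hy⟩ := hxmem
    have hxy : x * y⁻¹ ∈ lam.toMonoidHom.ker := by
      rw [MonoidHom.mem_ker, ContinuousMonoidHom.coe_toMonoidHom, map_mul, map_inv, mul_inv_eq_one]
      exact (Multiplicative.toAdd.injective hy).symm
    have := U.mul_mem (hkerU hxy) hyU
    rwa [inv_mul_cancel_right] at this

end Generator

/-! ## The decomposition group `D_v`, its subgroup `D_v ⊓ Gal(K̄/K_∞)`, and `γ_v − 1` -/

section Decomp

variable {K : Type u} [Field K] [NumberField K] {p : ℕ} [Fact p.Prime] (κ : ZpExtension K p)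
variable (M : Type u) [AddCommGroup M] [DistribMulAction (absoluteGaloisGroup K) M]
  [TopologicalSpace M] [DiscreteTopology M]

/-- `D_v` (as the subgroup `⊤ ⊓ D_v` carrying `localKer`) is compact: the image of the compact
`Γ_{K_v}` is closed in the compact `Γ_K`. [cite: NeukirchANT1999, Ch. II §9 Prop. (9.6)] -/
instance compactSpace_top_inf_decomp (v : HeightOneSpectrum (𝓞 K)) :
    CompactSpace ↥((⊤ : Subgroup (absoluteGaloisGroup K)) ⊓ decomp v) := by
  haveI : CharZero (v.adicCompletion K) :=
    charZero_of_injective_algebraMap (algebraMap K (v.adicCompletion K)).injective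
  have hcl : IsClosed (((⊤ : Subgroup (absoluteGaloisGroup K)) ⊓ decomp v :
      Subgroup (absoluteGaloisGroup K)) : Set (absoluteGaloisGroup K)) := by
    rw [Subgroup.coe_inf, Subgroup.coe_top, Set.univ_inter]
    exact isClosed_range_absGaloisRestrict K (v.adicCompletion K)
  exact isCompact_iff_compactSpace.mp hcl.isCompact

/-- **A topological generator `γ_v` of `D_v` modulo `D_v ⊓ Gal(K̄/K_∞)`**: there is `g ∈ D_v` such
that every open subgroup of `D_v` containing `D_v ⊓ ker κ` and `g` is all of `D_v`
(`κ(D_v) ≤ ℤ_p` is procyclic: `exists_generator_of_continuousMonoidHom_padicInt` for `κ|_{D_v}`).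
Greenberg: "`Γ_v = Gal(F_{∞,η}/F_v)` … topologically cyclic".
[cite: GreenbergLNM1716, §3 Lemma 3.3 (proof, p. 87)] -/
theorem exists_mem_decomp_generate (v : HeightOneSpectrum (𝓞 K)) :
    ∃ g : ↥((⊤ : Subgroup (absoluteGaloisGroup K)) ⊓ decomp v),
      ∀ U : Subgroup ↥((⊤ : Subgroup (absoluteGaloisGroup K)) ⊓ decomp v),
        IsOpen (U : Set ↥((⊤ : Subgroup (absoluteGaloisGroup K)) ⊓ decomp v)) →
          κ.kerSubgroup.subgroupOf ((⊤ : Subgroup (absoluteGaloisGroup K)) ⊓ decomp v) ≤ U →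
            g ∈ U → U = ⊤ := by
  let lam : ↥((⊤ : Subgroup (absoluteGaloisGroup K)) ⊓ decomp v) →ₜ* Multiplicative ℤ_[p] :=
    κ.toContinuousMonoidHom.comp (Literature.NumberTheory.GaloisRepresentations.subgroupIncl
      ((⊤ : Subgroup (absoluteGaloisGroup K)) ⊓ decomp v))
  obtain ⟨g, hg⟩ := exists_generator_of_continuousMonoidHom_padicInt lam
  refine ⟨g, fun U hU hNU hgU ↦ hg U hU (fun x hx ↦ hNU ?_) hgU⟩
  rw [Subgroup.mem_subgroupOf, ZpExtension.mem_kerSubgroup]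
  exact MonoidHom.mem_ker.mp hx

variable {M}

omit [TopologicalSpace M] [DiscreteTopology M] in
/-- `g ∈ D_v` maps the fixed points `B_v = M^{ker κ ⊓ D_v}` into themselves (`ker κ` is normal and
`g` normalises `D_v`). [folklore] -/
theorem smul_mem_fixedPoints_kerSubgroup_inf_decomp {v : HeightOneSpectrum (𝓞 K)}
    {g : absoluteGaloisGroup K} (hg : g ∈ decomp v)
    {b : M} (hb : b ∈ FixedPoints.addSubgroup ↥(κ.kerSubgroup ⊓ decomp v) M) :
    g • b ∈ FixedPoints.addSubgroup ↥(κ.kerSubgroup ⊓ decomp v) M := by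
  intro x
  have hx : (x : absoluteGaloisGroup K) ∈ κ.kerSubgroup ⊓ decomp v := x.2
  have hconj : g⁻¹ * (x : absoluteGaloisGroup K) * g ∈ κ.kerSubgroup ⊓ decomp v := by
    refine Subgroup.mem_inf.mpr ⟨?_, ?_⟩
    · have h := (inferInstance : κ.kerSubgroup.Normal).conj_mem _ (Subgroup.mem_inf.mp hx).1 g⁻¹
      rwa [inv_inv] at h
    · exact (decomp v).mul_mem ((decomp v).mul_mem ((decomp v).inv_mem hg)
        (Subgroup.mem_inf.mp hx).2) hg
  show (x : absoluteGaloisGroup K) • g • b = g • b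
  have h1 : (g⁻¹ * (x : absoluteGaloisGroup K) * g) • b = b := hb ⟨_, hconj⟩
  calc (x : absoluteGaloisGroup K) • g • b = g • (g⁻¹ * (x : absoluteGaloisGroup K) * g) • b := by
        rw [← mul_smul, ← mul_smul]; congr 1; group
    _ = g • b := by rw [h1]

variable (M) in
/-- **`γ_v − 1` on `B_v = M^{ker κ ⊓ D_v}`** for `g ∈ D_v` (Greenberg's `γ_v − 1` on
`B_v = E(F_{∞,η})[p^∞]`; `B_v/(γ_v − 1)B_v = H¹(Γ_v, B_v)`).
[cite: GreenbergLNM1716, §3 Lemma 3.3 (proof, p. 87)] -/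
def decompSubOne {v : HeightOneSpectrum (𝓞 K)} (g : absoluteGaloisGroup K) (hg : g ∈ decomp v) :
    FixedPoints.addSubgroup ↥(κ.kerSubgroup ⊓ decomp v) M →+
      FixedPoints.addSubgroup ↥(κ.kerSubgroup ⊓ decomp v) M where
  toFun b := ⟨g • (b : M) - b, (FixedPoints.addSubgroup _ M).sub_mem
    (smul_mem_fixedPoints_kerSubgroup_inf_decomp κ hg b.2) b.2⟩
  map_zero' := Subtype.ext (by simp)
  map_add' a b := Subtype.ext (by
    simp only [AddSubgroup.coe_add, smul_add, AddMemClass.mk_add_mk]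
    abel)

omit [TopologicalSpace M] [DiscreteTopology M] in
/-- Unfolding `decompSubOne`: `(γ_v − 1) b = g • b − b`. [folklore] -/
@[simp] theorem coe_decompSubOne_apply {v : HeightOneSpectrum (𝓞 K)} (g : absoluteGaloisGroup K)
    (hg : g ∈ decomp v) (b : FixedPoints.addSubgroup ↥(κ.kerSubgroup ⊓ decomp v) M) :
    (decompSubOne κ M g hg b : M) = g • (b : M) - b := rfl

/-- **`ker r_v ↪ B_v/(γ_v − 1)B_v` (inflation–restriction, Greenberg's Lemma 3.3, first step).**
For a discrete `Γ_K`-module `M` with continuous orbit maps, a `ℤ_p`-extension `κ`, a finite place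
`v` and `g ∈ D_v` generating `D_v` topologically together with `D_v ⊓ ker κ`
(`exists_mem_decomp_generate`): the local kernel `localKer (ker κ) M v =
ker (H¹(D_v, M) → H¹(ker κ ⊓ D_v, M))` is finite, of order at most `#(B_v/(γ_v − 1)B_v)`,
`B_v = M^{ker κ ⊓ D_v}`, whenever that quotient is finite (the generic
`ResKernel.finite_subgroupResKer` on the topological group `D_v`, transported as in the tree's proof
of Lemma 3.1, `WeierstrassCurve.finite_ker_layerToInfty_and_card_le`).
[cite: GreenbergLNM1716, §3 Lemma 3.3 (proof, p. 87)] [cite: SerreGaloisCohomology1997, I.§2.6] -/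
theorem finite_localKer_and_natCard_le (hcont : ∀ m : M, Continuous fun σ : absoluteGaloisGroup K ↦ σ • m)
    {v : HeightOneSpectrum (𝓞 K)} {g : ↥((⊤ : Subgroup (absoluteGaloisGroup K)) ⊓ decomp v)}
    (hgen : ∀ U : Subgroup ↥((⊤ : Subgroup (absoluteGaloisGroup K)) ⊓ decomp v),
      IsOpen (U : Set ↥((⊤ : Subgroup (absoluteGaloisGroup K)) ⊓ decomp v)) →
        κ.kerSubgroup.subgroupOf ((⊤ : Subgroup (absoluteGaloisGroup K)) ⊓ decomp v) ≤ U →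
          g ∈ U → U = ⊤)
    [Finite (FixedPoints.addSubgroup ↥(κ.kerSubgroup ⊓ decomp v) M ⧸
      (decompSubOne κ M (g : absoluteGaloisGroup K) (Subgroup.mem_inf.mp g.2).2).range)] :
    Finite (localKer κ.kerSubgroup M v) ∧
      Nat.card (localKer κ.kerSubgroup M v) ≤
        Nat.card (FixedPoints.addSubgroup ↥(κ.kerSubgroup ⊓ decomp v) M ⧸
          (decompSubOne κ M (g : absoluteGaloisGroup K) (Subgroup.mem_inf.mp g.2).2).range) := by
  -- notation
  let D : Subgroup (absoluteGaloisGroup K) := (⊤ : Subgroup (absoluteGaloisGroup K)) ⊓ decomp v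
  let N : Subgroup D := κ.kerSubgroup.subgroupOf D
  have hgD : (g : absoluteGaloisGroup K) ∈ decomp v := (Subgroup.mem_inf.mp g.2).2
  -- (1) orbit maps on `D_v` are continuous
  have hcont' : ∀ m : M, Continuous fun x : D ↦ x • m := fun m ↦
    (hcont m).comp continuous_subtype_val
  -- (2) `M^N = B_v`, compatibly with `γ_v − 1`
  have hfix : FixedPoints.addSubgroup N M =
      FixedPoints.addSubgroup ↥(κ.kerSubgroup ⊓ decomp v) M := by
    ext m
    simp only [FixedPoints.mem_addSubgroup]
    constructor
    · intro h x
      have hx := Subgroup.mem_inf.mp x.2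
      exact h ⟨⟨(x : absoluteGaloisGroup K), Subgroup.mem_inf.mpr ⟨Subgroup.mem_top _, hx.2⟩⟩,
        Subgroup.mem_subgroupOf.mpr hx.1⟩
    · intro h x
      exact h ⟨((x : D) : absoluteGaloisGroup K), Subgroup.mem_inf.mpr
        ⟨Subgroup.mem_subgroupOf.mp x.2, (Subgroup.mem_inf.mp (x : D).2).2⟩⟩
  let e : FixedPoints.addSubgroup N M ≃+ FixedPoints.addSubgroup ↥(κ.kerSubgroup ⊓ decomp v) M :=
    AddEquiv.addSubgroupCongr hfix
  have he : AddSubgroup.map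
      (e : FixedPoints.addSubgroup N M →+ FixedPoints.addSubgroup ↥(κ.kerSubgroup ⊓ decomp v) M)
      (subOne N M g).range = (decompSubOne κ M (g : absoluteGaloisGroup K) hgD).range := by
    ext b
    constructor
    · rintro ⟨x, ⟨y, rfl⟩, rfl⟩
      exact ⟨e y, Subtype.ext rfl⟩
    · rintro ⟨y, rfl⟩
      exact ⟨subOne N M g (e.symm y), ⟨e.symm y, rfl⟩, Subtype.ext rfl⟩
  let eq : FixedPoints.addSubgroup N M ⧸ (subOne N M g).range ≃+
      FixedPoints.addSubgroup ↥(κ.kerSubgroup ⊓ decomp v) M ⧸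
        (decompSubOne κ M (g : absoluteGaloisGroup K) hgD).range :=
    QuotientAddGroup.congr _ _ e he
  haveI : Finite (FixedPoints.addSubgroup N M ⧸ (subOne N M g).range) :=
    Finite.of_equiv _ eq.toEquiv.symm
  have hcard : Nat.card (FixedPoints.addSubgroup N M ⧸ (subOne N M g).range) =
      Nat.card (FixedPoints.addSubgroup ↥(κ.kerSubgroup ⊓ decomp v) M ⧸
        (decompSubOne κ M (g : absoluteGaloisGroup K) hgD).range) :=
    Nat.card_congr eq.toEquiv
  -- (3) the generic embedding `ker res ↪ M^N/(γ − 1)M^N` on `D_v`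
  obtain ⟨hfinK, hcardK⟩ := ResKernel.finite_subgroupResKer N M g hgen hcont'
  haveI := hfinK
  -- (4) `localKer ⊆ ker (res : H¹(D_v, M) → H¹(N, M))`
  have hker : localKer κ.kerSubgroup M v ≤ subgroupResKer M N := by
    intro c hc
    let j : N →ₜ* ↥(κ.kerSubgroup ⊓ decomp v) :=
      { toFun := fun x ↦ ⟨((x : D) : absoluteGaloisGroup K), Subgroup.mem_inf.mpr
          ⟨Subgroup.mem_subgroupOf.mp x.2, (Subgroup.mem_inf.mp (x : D).2).2⟩⟩
        map_one' := rfl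
        map_mul' := fun _ _ ↦ rfl
        continuous_toFun :=
          (continuous_subtype_val.comp continuous_subtype_val).subtype_mk _ }
    have hcomp : (resH1Hom j (AddMonoidHom.id M) (fun _ _ ↦ rfl)).comp
        (resOfLe M (inf_le_inf_right (decomp v) (le_top : κ.kerSubgroup ≤ ⊤))) =
        resSubgroup N M := by
      unfold Literature.NumberTheory.EllipticCurves.resOfLe ResKernel.resSubgroup
      rw [resH1Hom_comp]
      exact resH1Hom_congr (ContinuousMonoidHom.ext fun _ ↦ rfl) (AddMonoidHom.ext fun _ ↦ rfl) _ _
    rw [mem_subgroupResKer_iff, ← hcomp, AddMonoidHom.comp_apply,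
      (AddMonoidHom.mem_ker).mp hc, map_zero]
  have hinj := AddSubgroup.inclusion_injective hker
  exact ⟨Finite.of_injective _ hinj,
    (Nat.card_le_card_of_injective _ hinj).trans (hcardK.trans hcard.le)⟩

/-- **`ker r_v ↪ B_v/(γ_v − 1)B_v`, existential form**: there is `γ_v ∈ D_v` such that
`#localKer (ker κ) M v ≤ #(M^{ker κ ⊓ D_v}/(γ_v − 1))` whenever the right side is finite.
[cite: GreenbergLNM1716, §3 Lemma 3.3 (proof, p. 87)] -/
theorem exists_mem_decomp_natCard_localKer_le
    (hcont : ∀ m : M, Continuous fun σ : absoluteGaloisGroup K ↦ σ • m)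
    (v : HeightOneSpectrum (𝓞 K)) :
    ∃ (g : absoluteGaloisGroup K) (hg : g ∈ decomp v),
      Finite (FixedPoints.addSubgroup ↥(κ.kerSubgroup ⊓ decomp v) M ⧸
          (decompSubOne κ M g hg).range) →
        Finite (localKer κ.kerSubgroup M v) ∧
          Nat.card (localKer κ.kerSubgroup M v) ≤
            Nat.card (FixedPoints.addSubgroup ↥(κ.kerSubgroup ⊓ decomp v) M ⧸
              (decompSubOne κ M g hg).range) := by
  obtain ⟨g, hgen⟩ := exists_mem_decomp_generate κ v
  exact ⟨(g : absoluteGaloisGroup K), (Subgroup.mem_inf.mp g.2).2, fun _ ↦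
    finite_localKer_and_natCard_le κ hcont hgen⟩

/-- **`ker r_v = 0` as soon as `γ_v − 1` is ONTO `B_v = M^{ker κ ⊓ D_v}`** (then
`B_v/(γ_v − 1)B_v = 0` and `finite_localKer_and_natCard_le` gives `#ker r_v ≤ 1`). This is the
shape of Greenberg's Lemma 3.3 at a GOOD place `v ∤ p` ("if `E` has good reduction at `v`, then
`B_v = E[p^∞]` is divisible … `ker(r_v) = 0`", p. 87): there the surjectivity is Néron–Ogg–Shafarevich
+ divisibility + finiteness of the `γ_v`-kernel — NOT proved here (the sibling sub-cell's item);
this corollary is the interface. [cite: GreenbergLNM1716, §3 Lemma 3.3 (p. 87)] -/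
theorem localKer_eq_bot_of_decompSubOne_surjective
    (hcont : ∀ m : M, Continuous fun σ : absoluteGaloisGroup K ↦ σ • m)
    {v : HeightOneSpectrum (𝓞 K)} {g : ↥((⊤ : Subgroup (absoluteGaloisGroup K)) ⊓ decomp v)}
    (hgen : ∀ U : Subgroup ↥((⊤ : Subgroup (absoluteGaloisGroup K)) ⊓ decomp v),
      IsOpen (U : Set ↥((⊤ : Subgroup (absoluteGaloisGroup K)) ⊓ decomp v)) →
        κ.kerSubgroup.subgroupOf ((⊤ : Subgroup (absoluteGaloisGroup K)) ⊓ decomp v) ≤ U →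
          g ∈ U → U = ⊤)
    (hsurj : Function.Surjective
      (decompSubOne κ M (g : absoluteGaloisGroup K) (Subgroup.mem_inf.mp g.2).2)) :
    localKer κ.kerSubgroup M v = ⊥ := by
  have hrange : (decompSubOne κ M (g : absoluteGaloisGroup K) (Subgroup.mem_inf.mp g.2).2).range =
      ⊤ := AddMonoidHom.range_eq_top.mpr hsurj
  haveI : Subsingleton (FixedPoints.addSubgroup ↥(κ.kerSubgroup ⊓ decomp v) M ⧸
      (decompSubOne κ M (g : absoluteGaloisGroup K) (Subgroup.mem_inf.mp g.2).2).range) := by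
    rw [hrange]; exact QuotientAddGroup.subsingleton_quotient_top
  haveI : Finite (FixedPoints.addSubgroup ↥(κ.kerSubgroup ⊓ decomp v) M ⧸
      (decompSubOne κ M (g : absoluteGaloisGroup K) (Subgroup.mem_inf.mp g.2).2).range) :=
    Finite.of_subsingleton
  obtain ⟨hfin, hle⟩ := finite_localKer_and_natCard_le κ hcont hgen
  haveI := hfin
  exact AddSubgroup.eq_bot_of_card_le _
    (hle.trans ((Finite.card_le_one_iff_subsingleton).mpr inferInstance))

/-- **Existential form of the good-place interface**: there is `γ_v ∈ D_v` (a topological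
generator modulo `D_v ⊓ ker κ`, from `exists_mem_decomp_generate`) such that surjectivity of
`γ_v − 1` on `M^{ker κ ⊓ D_v}` implies `ker r_v = 0`. [cite: GreenbergLNM1716, §3 Lemma 3.3 (p. 87)] -/
theorem exists_generator_localKer_eq_bot_of_surjective
    (hcont : ∀ m : M, Continuous fun σ : absoluteGaloisGroup K ↦ σ • m)
    (v : HeightOneSpectrum (𝓞 K)) :
    ∃ (g : absoluteGaloisGroup K) (hg : g ∈ decomp v),
      Function.Surjective (decompSubOne κ M g hg) → localKer κ.kerSubgroup M v = ⊥ := by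
  obtain ⟨g, hgen⟩ := exists_mem_decomp_generate κ v
  exact ⟨(g : absoluteGaloisGroup K), (Subgroup.mem_inf.mp g.2).2, fun h ↦
    localKer_eq_bot_of_decompSubOne_surjective κ hcont hgen h⟩

end Decomp

end Summit.BirchSwinnertonDyer.Rank1Residual.X11b.AcSelmer

end
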